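import Mathlib.Analysis.Convex.Combination
import Literature.Probability.LatticeModels.TriangularIsoradialEmbedding
import Literature.Probability.Percolation.Isoradial
import HarnessLib

/-!
# The diamond graph of the triangular lattice is a rhombic tiling (the rhombille tiling)

Topic `Literature/Probability/Percolation`; theorems only. Companion of
`Literature.Probability.LatticeModels.TriangularIsoradialEmbedding` (the triangular lattice
`𝕋 = triGraph` as an isoradial graph: `triIsoradialEmbedding`, isoradial with all half-angles
`π/6`, canonical measure `bondPercolation triGraph (criticalWeightI (π/6))`). Here we prove the
remaining geometric clause of "`G` is isoradial if and only if its diamond graph `G^◇` is a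
rhombic tiling of the plane" (Grimmett–Manolescu, *Bond percolation on isoradial graphs*,
PTRF **159** (2014) 273–327 = arXiv:1204.0505, §2.1; the triangular lattice is listed in the
class `𝒢`, §1) in the tree's rendering `RhombicEmbedding.IsRhombicTiling`
(`Literature.Probability.Percolation.Isoradial`): the rhombi of distinct edges have disjoint
interiors, the rhombi cover the plane, and the face centres are pairwise distinct
(`triIsoradialEmbedding_isRhombicTiling`).

## The argument (coordinates for the rhombille tiling)

In the two linear coordinates `𝑈 q = 2 re q/√3`, `𝑊 q = re q/√3 + im q` (`triU`, `triW`) the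
vertex `x` of `𝕋` sits at the integer point `(2x₀ + x₁ − 1, x₀ + 2x₁ − 1)` and the centre of
the face `(y, t)` at `(2y₀ + y₁ + t, y₀ + 2y₁ + t)` (`triU_z`, `triW_z`, `triU_c`, `triW_c`); the
three classes are told apart by `𝑈 + 𝑊 (mod 3)`. Every edge carries one of the darts
`x → x + e₀`, `x → x + e₁`, `x → x − (1, −1)` (`exists_triDart_edge`), whose rhombi are the
parallelograms (`mem_convexHull_parallelogram`, corner coordinates `corners_triDart0/1/2`)
* `x₀ + 2x₁ − 1 ≤ 𝑊 ≤ x₀ + 2x₁`, `x₀ − x₁ ≤ 𝑈 − 𝑊 ≤ x₀ − x₁ + 1` (horizontal edges),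
* `2x₀ + x₁ − 1 ≤ 𝑈 ≤ 2x₀ + x₁`, `x₁ − x₀ ≤ 𝑊 − 𝑈 ≤ x₁ − x₀ + 1` (direction `ζ`),
* `2x₀ + x₁ − 2 ≤ 𝑈 ≤ 2x₀ + x₁ − 1`, `x₀ + 2x₁ − 1 ≤ 𝑊 ≤ x₀ + 2x₁` (direction `ζ²`),
with strict inequalities at interior points (`linear_lt_of_mem_interior`). Covering: with
`m = ⌊𝑈 q⌋`, `n = ⌊𝑊 q⌋`, the point `q` lies in a `ζ²`-cell if `m + n ≡ 0 (mod 3)` and otherwise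
in a horizontal or `ζ`-cell according to the order of the fractional parts
(`iUnion_rhombus_triIsoradialEmbedding`). Disjointness: a common interior point of two cells
forces, between families, a contradiction `mod 3`, and within a family equal cells
(`eq_of_mem_interior_rhombus_triIsoradialEmbedding`, by `omega`).

Consequence (to be recorded in a sequel importing `TriangularBoxCrossingProofs`): with this file,
`GrimmettManolescuAOP2013_triangular_boxCrossing_of_gm_boxCrossing` applies to
`triIsoradialEmbedding` with every structural hypothesis discharged except the printed
square-grid property — the box-crossing fact for critical bond percolation on `𝕋` follows from
`gm_boxCrossing triGraph triIsoradialEmbedding (π/6)` and `triIsoradialEmbedding.HasSquareGridPropertyGM`.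

## References

* G. R. Grimmett, I. Manolescu, PTRF 159 (2014) 273–327, arXiv:1204.0505, §2.1 (isoradial graphs
  and rhombic tilings), §1 (the class `𝒢` includes the triangular lattice).
* R. Kenyon, J.-M. Schlenker, *Rhombic embeddings of planar quad-graphs*, Trans. AMS 357 (2005),
  §1 (diamond graph / rhombic tiling).
-/

noncomputable section

namespace Literature.Probability.Percolation

open Complex Set Filter Topology
open Literature.Probability.LatticeModels

/-! ### Two linear coordinates adapted to the rhombille tiling -/

section Coordinates

/-- The coordinate `𝑈 q = 2 re q / √3`: on `triIsoradialEmbedding` it takes the integer value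
`2x₀ + x₁ − 1` at the vertex `x` and `2y₀ + y₁ + t` at the centre of the face `(y, t)`.
[folklore] -/
def triU : ℂ →ₗ[ℝ] ℝ := (2 / Real.sqrt 3) • Complex.reLm

/-- The coordinate `𝑊 q = re q / √3 + im q`: on `triIsoradialEmbedding` it takes the integer
value `x₀ + 2x₁ − 1` at the vertex `x` and `y₀ + 2y₁ + t` at the centre of the face `(y, t)`.
[folklore] -/
def triW : ℂ →ₗ[ℝ] ℝ := (1 / Real.sqrt 3) • Complex.reLm + Complex.imLm

/-- `𝑈` unfolded. [folklore] -/
theorem triU_apply (q : ℂ) : triU q = 2 / Real.sqrt 3 * q.re := by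
  simp [triU, Complex.reLm_coe]

/-- `𝑊` unfolded. [folklore] -/
theorem triW_apply (q : ℂ) : triW q = 1 / Real.sqrt 3 * q.re + q.im := by
  simp [triW, Complex.reLm_coe, Complex.imLm_coe]

/-- A point of the plane is determined by its two coordinates `𝑈, 𝑊`. [folklore] -/
theorem triUW_ext {p q : ℂ} (hU : triU p = triU q) (hW : triW p = triW q) : p = q := by
  have h3 : (0 : ℝ) < Real.sqrt 3 := by positivity
  rw [triU_apply, triU_apply] at hU
  rw [triW_apply, triW_apply] at hW
  have hre : p.re = q.re := by
    have := mul_left_cancel₀ (by positivity : (2 / Real.sqrt 3) ≠ 0) hU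
    exact this
  apply Complex.ext hre
  rw [hre] at hW
  linarith

/-- `𝑈` at a vertex of `triIsoradialEmbedding`. [folklore] -/
theorem triU_z (x : Site 2) : triU (triIsoradialEmbedding.z x) = 2 * x 0 + x 1 - 1 := by
  have h3 : Real.sqrt 3 ≠ 0 := by positivity
  rw [triU_apply]
  change 2 / Real.sqrt 3 * ((Real.sqrt 3 : ℂ) * (triEmbed x - (1 + triZeta) / 3)).re = _
  simp [triEmbed, triZeta_re, triZeta_im]
  field_simp
  ring

/-- `𝑊` at a vertex of `triIsoradialEmbedding`. [folklore] -/
theorem triW_z (x : Site 2) : triW (triIsoradialEmbedding.z x) = x 0 + 2 * x 1 - 1 := by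
  have h3 : Real.sqrt 3 ≠ 0 := by positivity
  have h3' : Real.sqrt 3 ^ 2 = 3 := Real.sq_sqrt (by norm_num)
  rw [triW_apply]
  change 1 / Real.sqrt 3 * ((Real.sqrt 3 : ℂ) * (triEmbed x - (1 + triZeta) / 3)).re +
    ((Real.sqrt 3 : ℂ) * (triEmbed x - (1 + triZeta) / 3)).im = _
  simp [triEmbed, triZeta_re, triZeta_im]
  field_simp
  rw [h3']
  ring

/-- `𝑈` at a face centre of `triIsoradialEmbedding`. [folklore] -/
theorem triU_c (y : Site 2) (t : Fin 2) :
    triU (triIsoradialEmbedding.c (y, t)) = 2 * y 0 + y 1 + (t : ℕ) := by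
  have h3 : Real.sqrt 3 ≠ 0 := by positivity
  rw [triU_apply]
  change 2 / Real.sqrt 3 * ((Real.sqrt 3 : ℂ) * (hexCenter (y, t) - (1 + triZeta) / 3)).re = _
  simp [hexCenter, triEmbed, triZeta_re, triZeta_im]
  field_simp
  ring

/-- `𝑊` at a face centre of `triIsoradialEmbedding`. [folklore] -/
theorem triW_c (y : Site 2) (t : Fin 2) :
    triW (triIsoradialEmbedding.c (y, t)) = y 0 + 2 * y 1 + (t : ℕ) := by
  have h3 : Real.sqrt 3 ≠ 0 := by positivity
  have h3' : Real.sqrt 3 ^ 2 = 3 := Real.sq_sqrt (by norm_num)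
  rw [triW_apply]
  change 1 / Real.sqrt 3 * ((Real.sqrt 3 : ℂ) * (hexCenter (y, t) - (1 + triZeta) / 3)).re +
    ((Real.sqrt 3 : ℂ) * (hexCenter (y, t) - (1 + triZeta) / 3)).im = _
  simp [hexCenter, triEmbed, triZeta_re, triZeta_im]
  field_simp
  rw [h3']
  ring

/-- `𝑊 i = 1 > 0` (a direction increasing `𝑊`). [folklore] -/
theorem triW_I : triW Complex.I = 1 := by simp [triW_apply]

/-- `𝑈 1 = 2/√3`. [folklore] -/
theorem triU_one : triU 1 = 2 / Real.sqrt 3 := by simp [triU_apply]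

/-- `𝑊 1 = 1/√3`. [folklore] -/
theorem triW_one : triW 1 = 1 / Real.sqrt 3 := by simp [triW_apply]

/-- `𝑈 i = 0`. [folklore] -/
theorem triU_I : triU Complex.I = 0 := by simp [triU_apply]

end Coordinates

/-! ### Parallelograms: convex hull, a half-plane test for interior points -/

section Parallelogram

/-- **A parallelogram is the convex hull of its corners** (the half we need): for
`s, t ∈ [0, 1]` the point `A + s u + t v` lies in `conv{A, A + u, A + u + v, A + v}`, as the
convex combination with weights `(1-s)(1-t), s(1-t), st, (1-s)t`. [folklore] -/
theorem mem_convexHull_parallelogram (A u v : ℂ) {s t : ℝ} (hs : s ∈ Icc (0 : ℝ) 1)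
    (ht : t ∈ Icc (0 : ℝ) 1) :
    A + (s : ℂ) * u + (t : ℂ) * v ∈ convexHull ℝ ({A, A + u, A + u + v, A + v} : Set ℂ) := by
  obtain ⟨hs0, hs1⟩ := hs
  obtain ⟨ht0, ht1⟩ := ht
  have hconv : Convex ℝ (convexHull ℝ ({A, A + u, A + u + v, A + v} : Set ℂ)) :=
    convex_convexHull ℝ _
  have hin : ∀ X ∈ ({A, A + u, A + u + v, A + v} : Set ℂ),
      X ∈ convexHull ℝ ({A, A + u, A + u + v, A + v} : Set ℂ) :=
    fun X hX => subset_convexHull ℝ _ hX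
  have key := hconv.sum_mem (t := Finset.univ)
    (w := ![(1 - s) * (1 - t), s * (1 - t), s * t, (1 - s) * t])
    (z := ![A, A + u, A + u + v, A + v])
    (by intro i _; fin_cases i <;> simp <;> nlinarith)
    (by simp [Fin.sum_univ_four]; ring)
    (by intro i _; fin_cases i <;> simp [hin])
  have hw_eq : A + (s : ℂ) * u + (t : ℂ) * v =
      ∑ i, (![(1 - s) * (1 - t), s * (1 - t), s * t, (1 - s) * t] i) •
        (![A, A + u, A + u + v, A + v] i) := by
    simp only [Fin.sum_univ_four, Matrix.cons_val_zero, Matrix.cons_val_one, Matrix.cons_val,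
      Complex.real_smul]
    push_cast
    ring
  rw [hw_eq]
  exact key

/-- **Linear functionals are bounded on a convex hull by their bounds on the generators.**
[folklore] -/
theorem linear_mem_Icc_of_mem_convexHull (φ : ℂ →ₗ[ℝ] ℝ) {S : Set ℂ} {lo hi : ℝ}
    (hS : ∀ X ∈ S, φ X ∈ Icc lo hi) {q : ℂ} (hq : q ∈ convexHull ℝ S) : φ q ∈ Icc lo hi := by
  have hconv : Convex ℝ (φ ⁻¹' Icc lo hi) := (convex_Icc lo hi).linear_preimage φ
  exact convexHull_min (fun X hX => hS X hX) hconv hq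

/-- **Interior points are strictly inside every supporting slab.** If `φ ≤ hi` on `K` and
`φ w > 0` for some direction `w`, then `φ q < hi` at every interior point `q` of `K` (move a
little in the direction `w`). [folklore] -/
theorem linear_lt_of_mem_interior (φ : ℂ →ₗ[ℝ] ℝ) {K : Set ℂ} {hi : ℝ} (w : ℂ) (hw : 0 < φ w)
    (hK : ∀ X ∈ K, φ X ≤ hi) {q : ℂ} (hq : q ∈ interior K) : φ q < hi := by
  have hcont : Continuous fun s : ℝ => q + (s : ℂ) * w := by fun_prop
  have hev : ∀ᶠ s : ℝ in 𝓝 0, q + (↑s : ℂ) * w ∈ interior K := by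
    have h0 : (fun s : ℝ => q + (s : ℂ) * w) 0 ∈ interior K := by simpa using hq
    exact hcont.continuousAt.eventually_mem (isOpen_interior.mem_nhds h0)
  have hev' : ∀ᶠ s : ℝ in 𝓝[>] 0, q + (↑s : ℂ) * w ∈ interior K ∧ 0 < s :=
    (hev.filter_mono nhdsWithin_le_nhds).and self_mem_nhdsWithin
  obtain ⟨s, hsK, hs0⟩ := hev'.exists
  have h1 := hK _ (interior_subset hsK)
  have h2 : φ (q + (s : ℂ) * w) = φ q + s * φ w := by
    rw [map_add, show (s : ℂ) * w = s • w from (Complex.real_smul).symm, map_smul, smul_eq_mul]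
  rw [h2] at h1
  nlinarith

/-- The lower-bound form of `linear_lt_of_mem_interior`. [folklore] -/
theorem linear_gt_of_mem_interior (φ : ℂ →ₗ[ℝ] ℝ) {K : Set ℂ} {lo : ℝ} (w : ℂ) (hw : 0 < φ w)
    (hK : ∀ X ∈ K, lo ≤ φ X) {q : ℂ} (hq : q ∈ interior K) : lo < φ q := by
  have h := linear_lt_of_mem_interior (-φ) (hi := -lo) (-w) (by simpa using hw)
    (fun X hX => by simpa using hK X hX) hq
  simpa using h

end Parallelogram

/-! ### The three kinds of edges of `𝕋` and their rhombi -/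

section Darts

/-- The rhombus of an edge computed from any dart over it (the corner set `{z x, c f, z y, c g}`
is invariant under reversing the dart, by `leftFace_symm`; as `RhombicEmbedding.rhombus_eq_of_dart_edge`
of `IsoradialProofs`, re-proved here to keep the imports light). (Grimmett–Manolescu 2014, §2.1:
rhombi are attached to unoriented edges.) [folklore] -/
theorem rhombus_triIsoradialEmbedding_eq_of_dart_edge {d : triGraph.Dart} {e : triGraph.edgeSet}
    (hd : d.edge = e) :
    triIsoradialEmbedding.rhombus e =
      convexHull ℝ {triIsoradialEmbedding.z d.fst, triIsoradialEmbedding.c (triIsoradialEmbedding.leftFace d),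
        triIsoradialEmbedding.z d.snd, triIsoradialEmbedding.c (triIsoradialEmbedding.rightFace d)} := by
  have h := triIsoradialEmbedding_isIsoradial
  unfold RhombicEmbedding.rhombus
  have h' : (RhombicEmbedding.refDart e).edge = d.edge := by
    rw [RhombicEmbedding.refDart_edge, hd]
  rcases (SimpleGraph.dart_edge_eq_iff _ _).1 h' with h'' | h''
  · rw [h'']
  · rw [h'']
    have h1 := h.leftFace_symm d
    have h2 := h.leftFace_symm d.symm
    rw [SimpleGraph.Dart.symm_symm] at h2
    simp only [SimpleGraph.Dart.symm_toProd, Prod.fst_swap, Prod.snd_swap, h1, ← h2]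
    congr 1
    ext w
    simp only [mem_insert_iff, mem_singleton_iff]
    tauto

/-- The dart `x → x + e₀` (horizontal edges). [folklore] -/
def triDart0 (x : Site 2) : triGraph.Dart := ⟨(x, x + Pi.single 0 1), triGraph_adj_self_add_single x 0⟩

/-- The dart `x → x + e₁` (edges of direction `ζ`). [folklore] -/
def triDart1 (x : Site 2) : triGraph.Dart := ⟨(x, x + Pi.single 1 1), triGraph_adj_self_add_single x 1⟩

/-- The dart `x → x - (1, -1)` (edges of direction `ζ²`). [folklore] -/
def triDart2 (x : Site 2) : triGraph.Dart := ⟨(x, x - triDiag), triGraph_adj_self_sub_triDiag x⟩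

/-- **Every edge of `𝕋` carries one of the three standard darts.** [folklore] -/
theorem exists_triDart_edge (e : triGraph.edgeSet) :
    ∃ x : Site 2, (triDart0 x).edge = (e : Sym2 (Site 2)) ∨ (triDart1 x).edge = (e : Sym2 (Site 2)) ∨
      (triDart2 x).edge = (e : Sym2 (Site 2)) := by
  obtain ⟨e, he⟩ := e
  induction e using Sym2.ind with
  | _ x y =>
    have hadj : triGraph.Adj x y := by rwa [SimpleGraph.mem_edgeSet] at he
    change ∃ x₀ : Site 2, (triDart0 x₀).edge = s(x, y) ∨ (triDart1 x₀).edge = s(x, y) ∨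
      (triDart2 x₀).edge = s(x, y)
    rcases (triGraph_adj_iff_eq_add x y).1 hadj with h | h | h | h | h | h
    · exact ⟨x, Or.inl (by rw [h]; rfl)⟩
    · refine ⟨y, Or.inl ?_⟩
      change s(y, y + Pi.single 0 1) = s(x, y)
      rw [Sym2.eq_swap, h]; congr 1; abel
    · exact ⟨x, Or.inr (Or.inl (by rw [h]; rfl))⟩
    · refine ⟨y, Or.inr (Or.inl ?_)⟩
      change s(y, y + Pi.single 1 1) = s(x, y)
      rw [Sym2.eq_swap, h]; congr 1; abel
    · refine ⟨y, Or.inr (Or.inr ?_)⟩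
      change s(y, y - triDiag) = s(x, y)
      rw [Sym2.eq_swap, h]; congr 1; abel
    · refine ⟨x, Or.inr (Or.inr ?_)⟩
      change s(x, x - triDiag) = s(x, y)
      rw [h, sub_eq_add_neg]

/-- The faces of the horizontal dart `x → x + e₀`: left `(x, up)`, right `(x - e₁, down)`.
[folklore] -/
theorem triEdgeFaces_triDart0 (x : Site 2) :
    triEdgeFaces (triDart0 x) = ((x, 0), (x - Pi.single 1 1, 1)) := by
  change (triFace x (x + Pi.single 0 1) (x + triRot60 (x + Pi.single 0 1 - x)),
    triFace x (x + Pi.single 0 1) (x + triRotNeg60 (x + Pi.single 0 1 - x))) = _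
  rw [add_sub_cancel_left]
  have h1 := triFace_add x 0 (Pi.single 0 1) (triRot60 (Pi.single 0 1))
  have h2 := triFace_add x 0 (Pi.single 0 1) (triRotNeg60 (Pi.single 0 1))
  rw [add_zero] at h1 h2
  rw [h1, h2, show triFace 0 (Pi.single 0 1) (triRot60 (Pi.single 0 1)) = ((0 : Site 2), (0 : Fin 2))
      from by decide,
    show triFace 0 (Pi.single 0 1) (triRotNeg60 (Pi.single 0 1)) = (-Pi.single 1 1, (1 : Fin 2))
      from by decide]
  simp [sub_eq_add_neg]

/-- The faces of the dart `x → x + e₁`: left `(x - e₀, down)`, right `(x, up)`. [folklore] -/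
theorem triEdgeFaces_triDart1 (x : Site 2) :
    triEdgeFaces (triDart1 x) = ((x - Pi.single 0 1, 1), (x, 0)) := by
  change (triFace x (x + Pi.single 1 1) (x + triRot60 (x + Pi.single 1 1 - x)),
    triFace x (x + Pi.single 1 1) (x + triRotNeg60 (x + Pi.single 1 1 - x))) = _
  rw [add_sub_cancel_left]
  have h1 := triFace_add x 0 (Pi.single 1 1) (triRot60 (Pi.single 1 1))
  have h2 := triFace_add x 0 (Pi.single 1 1) (triRotNeg60 (Pi.single 1 1))
  rw [add_zero] at h1 h2
  rw [h1, h2, show triFace 0 (Pi.single 1 1) (triRot60 (Pi.single 1 1)) = (-Pi.single 0 1, (1 : Fin 2))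
      from by decide,
    show triFace 0 (Pi.single 1 1) (triRotNeg60 (Pi.single 1 1)) = ((0 : Site 2), (0 : Fin 2))
      from by decide]
  simp [sub_eq_add_neg]

/-- The faces of the dart `x → x - (1, -1)`: left `(x - e₀, up)`, right `(x - e₀, down)`.
[folklore] -/
theorem triEdgeFaces_triDart2 (x : Site 2) :
    triEdgeFaces (triDart2 x) = ((x - Pi.single 0 1, 0), (x - Pi.single 0 1, 1)) := by
  change (triFace x (x - triDiag) (x + triRot60 (x - triDiag - x)),
    triFace x (x - triDiag) (x + triRotNeg60 (x - triDiag - x))) = _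
  rw [show x - triDiag - x = -triDiag by abel, sub_eq_add_neg x triDiag]
  have h1 := triFace_add x 0 (-triDiag) (triRot60 (-triDiag))
  have h2 := triFace_add x 0 (-triDiag) (triRotNeg60 (-triDiag))
  rw [add_zero] at h1 h2
  rw [h1, h2, show triFace 0 (-triDiag) (triRot60 (-triDiag)) = (-Pi.single 0 1, (0 : Fin 2))
      from by decide,
    show triFace 0 (-triDiag) (triRotNeg60 (-triDiag)) = (-Pi.single 0 1, (1 : Fin 2))
      from by decide]
  simp [sub_eq_add_neg]

/-- The rhombus of a horizontal edge, corners listed. [folklore] -/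
theorem rhombus_triDart0 (x : Site 2) :
    triIsoradialEmbedding.rhombus ⟨(triDart0 x).edge, (triDart0 x).edge_mem⟩ =
      convexHull ℝ {triIsoradialEmbedding.z x, triIsoradialEmbedding.c (x, 0),
        triIsoradialEmbedding.z (x + Pi.single 0 1),
        triIsoradialEmbedding.c (x - Pi.single 1 1, 1)} := by
  rw [rhombus_triIsoradialEmbedding_eq_of_dart_edge rfl,
    triIsoradialEmbedding_leftFace, triIsoradialEmbedding_rightFace, triEdgeFaces_triDart0]
  rfl

/-- The rhombus of an edge of direction `ζ`, corners listed. [folklore] -/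
theorem rhombus_triDart1 (x : Site 2) :
    triIsoradialEmbedding.rhombus ⟨(triDart1 x).edge, (triDart1 x).edge_mem⟩ =
      convexHull ℝ {triIsoradialEmbedding.z x, triIsoradialEmbedding.c (x - Pi.single 0 1, 1),
        triIsoradialEmbedding.z (x + Pi.single 1 1), triIsoradialEmbedding.c (x, 0)} := by
  rw [rhombus_triIsoradialEmbedding_eq_of_dart_edge rfl,
    triIsoradialEmbedding_leftFace, triIsoradialEmbedding_rightFace, triEdgeFaces_triDart1]
  rfl

/-- The rhombus of an edge of direction `ζ²`, corners listed. [folklore] -/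
theorem rhombus_triDart2 (x : Site 2) :
    triIsoradialEmbedding.rhombus ⟨(triDart2 x).edge, (triDart2 x).edge_mem⟩ =
      convexHull ℝ {triIsoradialEmbedding.z x, triIsoradialEmbedding.c (x - Pi.single 0 1, 0),
        triIsoradialEmbedding.z (x - triDiag), triIsoradialEmbedding.c (x - Pi.single 0 1, 1)} := by
  rw [rhombus_triIsoradialEmbedding_eq_of_dart_edge rfl,
    triIsoradialEmbedding_leftFace, triIsoradialEmbedding_rightFace, triEdgeFaces_triDart2]
  rfl

end Darts

/-! ### Coordinates of the corners -/

section Corners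

variable (x : Site 2)

/-- Corner coordinates, horizontal edge. [folklore] -/
theorem corners_triDart0 :
    (triU (triIsoradialEmbedding.z x) = ((2 * x 0 + x 1 - 1 : ℤ) : ℝ) ∧
      triW (triIsoradialEmbedding.z x) = ((x 0 + 2 * x 1 - 1 : ℤ) : ℝ)) ∧
    (triU (triIsoradialEmbedding.c (x, 0)) = ((2 * x 0 + x 1 : ℤ) : ℝ) ∧
      triW (triIsoradialEmbedding.c (x, 0)) = ((x 0 + 2 * x 1 : ℤ) : ℝ)) ∧
    (triU (triIsoradialEmbedding.z (x + Pi.single 0 1)) = ((2 * x 0 + x 1 + 1 : ℤ) : ℝ) ∧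
      triW (triIsoradialEmbedding.z (x + Pi.single 0 1)) = ((x 0 + 2 * x 1 : ℤ) : ℝ)) ∧
    (triU (triIsoradialEmbedding.c (x - Pi.single 1 1, 1)) = ((2 * x 0 + x 1 : ℤ) : ℝ) ∧
      triW (triIsoradialEmbedding.c (x - Pi.single 1 1, 1)) = ((x 0 + 2 * x 1 - 1 : ℤ) : ℝ)) := by
  refine ⟨⟨?_, ?_⟩, ⟨?_, ?_⟩, ⟨?_, ?_⟩, ⟨?_, ?_⟩⟩ <;>
    (first
      | rw [triU_z]
      | rw [triW_z]
      | rw [triU_c]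
      | rw [triW_c]) <;>
    simp <;> ring

/-- Corner coordinates, edge of direction `ζ`. [folklore] -/
theorem corners_triDart1 :
    (triU (triIsoradialEmbedding.z x) = ((2 * x 0 + x 1 - 1 : ℤ) : ℝ) ∧
      triW (triIsoradialEmbedding.z x) = ((x 0 + 2 * x 1 - 1 : ℤ) : ℝ)) ∧
    (triU (triIsoradialEmbedding.c (x - Pi.single 0 1, 1)) = ((2 * x 0 + x 1 - 1 : ℤ) : ℝ) ∧
      triW (triIsoradialEmbedding.c (x - Pi.single 0 1, 1)) = ((x 0 + 2 * x 1 : ℤ) : ℝ)) ∧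
    (triU (triIsoradialEmbedding.z (x + Pi.single 1 1)) = ((2 * x 0 + x 1 : ℤ) : ℝ) ∧
      triW (triIsoradialEmbedding.z (x + Pi.single 1 1)) = ((x 0 + 2 * x 1 + 1 : ℤ) : ℝ)) ∧
    (triU (triIsoradialEmbedding.c (x, 0)) = ((2 * x 0 + x 1 : ℤ) : ℝ) ∧
      triW (triIsoradialEmbedding.c (x, 0)) = ((x 0 + 2 * x 1 : ℤ) : ℝ)) := by
  refine ⟨⟨?_, ?_⟩, ⟨?_, ?_⟩, ⟨?_, ?_⟩, ⟨?_, ?_⟩⟩ <;>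
    (first
      | rw [triU_z]
      | rw [triW_z]
      | rw [triU_c]
      | rw [triW_c]) <;>
    simp <;> ring

/-- Corner coordinates, edge of direction `ζ²`. [folklore] -/
theorem corners_triDart2 :
    (triU (triIsoradialEmbedding.z x) = ((2 * x 0 + x 1 - 1 : ℤ) : ℝ) ∧
      triW (triIsoradialEmbedding.z x) = ((x 0 + 2 * x 1 - 1 : ℤ) : ℝ)) ∧
    (triU (triIsoradialEmbedding.c (x - Pi.single 0 1, 0)) = ((2 * x 0 + x 1 - 2 : ℤ) : ℝ) ∧
      triW (triIsoradialEmbedding.c (x - Pi.single 0 1, 0)) = ((x 0 + 2 * x 1 - 1 : ℤ) : ℝ)) ∧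
    (triU (triIsoradialEmbedding.z (x - triDiag)) = ((2 * x 0 + x 1 - 2 : ℤ) : ℝ) ∧
      triW (triIsoradialEmbedding.z (x - triDiag)) = ((x 0 + 2 * x 1 : ℤ) : ℝ)) ∧
    (triU (triIsoradialEmbedding.c (x - Pi.single 0 1, 1)) = ((2 * x 0 + x 1 - 1 : ℤ) : ℝ) ∧
      triW (triIsoradialEmbedding.c (x - Pi.single 0 1, 1)) = ((x 0 + 2 * x 1 : ℤ) : ℝ)) := by
  refine ⟨⟨?_, ?_⟩, ⟨?_, ?_⟩, ⟨?_, ?_⟩, ⟨?_, ?_⟩⟩ <;>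
    (first
      | rw [triU_z]
      | rw [triW_z]
      | rw [triU_c]
      | rw [triW_c]) <;>
    simp <;> ring

end Corners

/-! ### The rhombi in coordinates: three families of unit cells -/

section Regions

/-- Solving for the two parallelogram coordinates through `𝑈, 𝑊`. [folklore] -/
theorem eq_parallelogram_point {A u v q : ℂ} {s t : ℝ}
    (hU : triU q = triU A + s * triU u + t * triU v)
    (hW : triW q = triW A + s * triW u + t * triW v) :
    q = A + (s : ℂ) * u + (t : ℂ) * v := by
  have e1 : (s : ℂ) * u = s • u := (Complex.real_smul).symm
  have e2 : (t : ℂ) * v = t • v := (Complex.real_smul).symm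
  apply triUW_ext
  · rw [hU, map_add, map_add, e1, e2, map_smul, map_smul, smul_eq_mul, smul_eq_mul]
  · rw [hW, map_add, map_add, e1, e2, map_smul, map_smul, smul_eq_mul, smul_eq_mul]

/-- `(𝑈 - 𝑊) 1 = 1/√3 > 0`. [folklore] -/
theorem triU_sub_triW_one_pos : 0 < (triU - triW) 1 := by
  have h3 : 0 < Real.sqrt 3 := by positivity
  rw [LinearMap.sub_apply, triU_one, triW_one, div_sub_div_same]
  norm_num

/-- `(𝑊 - 𝑈) i = 1 > 0`. [folklore] -/
theorem triW_sub_triU_I_pos : 0 < (triW - triU) Complex.I := by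
  rw [LinearMap.sub_apply, triW_I, triU_I]; norm_num

/-- `𝑈 1 > 0`. [folklore] -/
theorem triU_one_pos : 0 < triU 1 := by rw [triU_one]; positivity

/-- `𝑊 i > 0`. [folklore] -/
theorem triW_I_pos : 0 < triW Complex.I := by rw [triW_I]; norm_num

variable {x : Site 2} {q : ℂ}

/-- **Horizontal rhombi in coordinates** (closed form): on the rhombus of `x → x + e₀`,
`x₀ + 2x₁ - 1 ≤ 𝑊 ≤ x₀ + 2x₁` and `x₀ - x₁ ≤ 𝑈 - 𝑊 ≤ x₀ - x₁ + 1`. [folklore] -/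
theorem bounds_of_mem_rhombus_triDart0
    (hq : q ∈ triIsoradialEmbedding.rhombus ⟨(triDart0 x).edge, (triDart0 x).edge_mem⟩) :
    triW q ∈ Icc ((x 0 + 2 * x 1 - 1 : ℤ) : ℝ) ((x 0 + 2 * x 1 : ℤ) : ℝ) ∧
      (triU - triW) q ∈ Icc ((x 0 - x 1 : ℤ) : ℝ) ((x 0 - x 1 + 1 : ℤ) : ℝ) := by
  obtain ⟨⟨h1, h2⟩, ⟨h3, h4⟩, ⟨h5, h6⟩, ⟨h7, h8⟩⟩ := corners_triDart0 x
  rw [rhombus_triDart0] at hq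
  constructor
  · refine linear_mem_Icc_of_mem_convexHull triW (fun X hX => ?_) hq
    simp only [mem_insert_iff, mem_singleton_iff] at hX
    rcases hX with rfl | rfl | rfl | rfl <;> simp only [h2, h4, h6, h8] <;>
      constructor <;> push_cast <;> linarith
  · refine linear_mem_Icc_of_mem_convexHull (triU - triW) (fun X hX => ?_) hq
    simp only [mem_insert_iff, mem_singleton_iff] at hX
    rcases hX with rfl | rfl | rfl | rfl <;>
      simp only [LinearMap.sub_apply, h1, h2, h3, h4, h5, h6, h7, h8] <;>
      constructor <;> push_cast <;> linarith

/-- **Horizontal rhombi in coordinates** (interior form, strict inequalities). [folklore] -/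
theorem sbounds_of_mem_interior_rhombus_triDart0
    (hq : q ∈ interior (triIsoradialEmbedding.rhombus ⟨(triDart0 x).edge, (triDart0 x).edge_mem⟩)) :
    ((x 0 + 2 * x 1 - 1 : ℤ) : ℝ) < triW q ∧ triW q < ((x 0 + 2 * x 1 : ℤ) : ℝ) ∧
      ((x 0 - x 1 : ℤ) : ℝ) < triU q - triW q ∧ triU q - triW q < ((x 0 - x 1 + 1 : ℤ) : ℝ) := by
  have hb := fun X (hX : X ∈ triIsoradialEmbedding.rhombus ⟨(triDart0 x).edge, (triDart0 x).edge_mem⟩) =>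
    bounds_of_mem_rhombus_triDart0 hX
  refine ⟨linear_gt_of_mem_interior triW Complex.I triW_I_pos (fun X hX => (hb X hX).1.1) hq,
    linear_lt_of_mem_interior triW Complex.I triW_I_pos (fun X hX => (hb X hX).1.2) hq, ?_, ?_⟩
  · have := linear_gt_of_mem_interior (triU - triW) 1 triU_sub_triW_one_pos
      (fun X hX => (hb X hX).2.1) hq
    rwa [LinearMap.sub_apply] at this
  · have := linear_lt_of_mem_interior (triU - triW) 1 triU_sub_triW_one_pos
      (fun X hX => (hb X hX).2.2) hq
    rwa [LinearMap.sub_apply] at this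

/-- **Horizontal rhombi in coordinates** (converse): the closed cell is contained in the rhombus.
[folklore] -/
theorem mem_rhombus_triDart0_of_bounds
    (h1 : ((x 0 + 2 * x 1 - 1 : ℤ) : ℝ) ≤ triW q) (h2 : triW q ≤ ((x 0 + 2 * x 1 : ℤ) : ℝ))
    (h3 : ((x 0 - x 1 : ℤ) : ℝ) ≤ triU q - triW q) (h4 : triU q - triW q ≤ ((x 0 - x 1 + 1 : ℤ) : ℝ)) :
    q ∈ triIsoradialEmbedding.rhombus ⟨(triDart0 x).edge, (triDart0 x).edge_mem⟩ := by
  obtain ⟨⟨c1, c2⟩, ⟨c3, c4⟩, ⟨c5, c6⟩, ⟨c7, c8⟩⟩ := corners_triDart0 x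
  rw [rhombus_triDart0]
  push_cast at h1 h2 h3 h4 c1 c2 c3 c4 c5 c6 c7 c8
  have hq : q = triIsoradialEmbedding.z x +
      ((triW q - (x 0 + 2 * x 1 - 1) : ℝ) : ℂ) *
        (triIsoradialEmbedding.c (x, 0) - triIsoradialEmbedding.z x) +
      ((triU q - triW q - (x 0 - x 1) : ℝ) : ℂ) *
        (triIsoradialEmbedding.c (x - Pi.single 1 1, 1) - triIsoradialEmbedding.z x) := by
    apply eq_parallelogram_point
    · rw [map_sub, map_sub, c1, c3, c7]; ring
    · rw [map_sub, map_sub, c2, c4, c8]; ring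
  have hB : triIsoradialEmbedding.z x + (triIsoradialEmbedding.c (x, 0) - triIsoradialEmbedding.z x) +
      (triIsoradialEmbedding.c (x - Pi.single 1 1, 1) - triIsoradialEmbedding.z x) =
      triIsoradialEmbedding.z (x + Pi.single 0 1) := by
    apply triUW_ext
    · simp only [map_add, map_sub, c1, c3, c5, c7]; ring
    · simp only [map_add, map_sub, c2, c4, c6, c8]; ring
  have key := mem_convexHull_parallelogram (triIsoradialEmbedding.z x)
    (triIsoradialEmbedding.c (x, 0) - triIsoradialEmbedding.z x)
    (triIsoradialEmbedding.c (x - Pi.single 1 1, 1) - triIsoradialEmbedding.z x)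
    (s := triW q - (x 0 + 2 * x 1 - 1)) (t := triU q - triW q - (x 0 - x 1))
    ⟨by linarith, by linarith⟩ ⟨by linarith, by linarith⟩
  rw [hB, add_sub_cancel, add_sub_cancel] at key
  rw [hq]
  exact key

/-- **Rhombi of direction `ζ` in coordinates** (closed form): `2x₀ + x₁ - 1 ≤ 𝑈 ≤ 2x₀ + x₁` and
`x₁ - x₀ ≤ 𝑊 - 𝑈 ≤ x₁ - x₀ + 1`. [folklore] -/
theorem bounds_of_mem_rhombus_triDart1
    (hq : q ∈ triIsoradialEmbedding.rhombus ⟨(triDart1 x).edge, (triDart1 x).edge_mem⟩) :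
    triU q ∈ Icc ((2 * x 0 + x 1 - 1 : ℤ) : ℝ) ((2 * x 0 + x 1 : ℤ) : ℝ) ∧
      (triW - triU) q ∈ Icc ((x 1 - x 0 : ℤ) : ℝ) ((x 1 - x 0 + 1 : ℤ) : ℝ) := by
  obtain ⟨⟨h1, h2⟩, ⟨h3, h4⟩, ⟨h5, h6⟩, ⟨h7, h8⟩⟩ := corners_triDart1 x
  rw [rhombus_triDart1] at hq
  constructor
  · refine linear_mem_Icc_of_mem_convexHull triU (fun X hX => ?_) hq
    simp only [mem_insert_iff, mem_singleton_iff] at hX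
    rcases hX with rfl | rfl | rfl | rfl <;> simp only [h1, h3, h5, h7] <;>
      constructor <;> push_cast <;> linarith
  · refine linear_mem_Icc_of_mem_convexHull (triW - triU) (fun X hX => ?_) hq
    simp only [mem_insert_iff, mem_singleton_iff] at hX
    rcases hX with rfl | rfl | rfl | rfl <;>
      simp only [LinearMap.sub_apply, h1, h2, h3, h4, h5, h6, h7, h8] <;>
      constructor <;> push_cast <;> linarith

/-- **Rhombi of direction `ζ` in coordinates** (interior form). [folklore] -/
theorem sbounds_of_mem_interior_rhombus_triDart1
    (hq : q ∈ interior (triIsoradialEmbedding.rhombus ⟨(triDart1 x).edge, (triDart1 x).edge_mem⟩)) :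
    ((2 * x 0 + x 1 - 1 : ℤ) : ℝ) < triU q ∧ triU q < ((2 * x 0 + x 1 : ℤ) : ℝ) ∧
      ((x 1 - x 0 : ℤ) : ℝ) < triW q - triU q ∧ triW q - triU q < ((x 1 - x 0 + 1 : ℤ) : ℝ) := by
  have hb := fun X (hX : X ∈ triIsoradialEmbedding.rhombus ⟨(triDart1 x).edge, (triDart1 x).edge_mem⟩) =>
    bounds_of_mem_rhombus_triDart1 hX
  refine ⟨linear_gt_of_mem_interior triU 1 triU_one_pos (fun X hX => (hb X hX).1.1) hq,
    linear_lt_of_mem_interior triU 1 triU_one_pos (fun X hX => (hb X hX).1.2) hq, ?_, ?_⟩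
  · have := linear_gt_of_mem_interior (triW - triU) Complex.I triW_sub_triU_I_pos
      (fun X hX => (hb X hX).2.1) hq
    rwa [LinearMap.sub_apply] at this
  · have := linear_lt_of_mem_interior (triW - triU) Complex.I triW_sub_triU_I_pos
      (fun X hX => (hb X hX).2.2) hq
    rwa [LinearMap.sub_apply] at this

/-- **Rhombi of direction `ζ` in coordinates** (converse). [folklore] -/
theorem mem_rhombus_triDart1_of_bounds
    (h1 : ((2 * x 0 + x 1 - 1 : ℤ) : ℝ) ≤ triU q) (h2 : triU q ≤ ((2 * x 0 + x 1 : ℤ) : ℝ))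
    (h3 : ((x 1 - x 0 : ℤ) : ℝ) ≤ triW q - triU q) (h4 : triW q - triU q ≤ ((x 1 - x 0 + 1 : ℤ) : ℝ)) :
    q ∈ triIsoradialEmbedding.rhombus ⟨(triDart1 x).edge, (triDart1 x).edge_mem⟩ := by
  obtain ⟨⟨c1, c2⟩, ⟨c3, c4⟩, ⟨c5, c6⟩, ⟨c7, c8⟩⟩ := corners_triDart1 x
  rw [rhombus_triDart1]
  push_cast at h1 h2 h3 h4 c1 c2 c3 c4 c5 c6 c7 c8
  have hq : q = triIsoradialEmbedding.z x +
      ((triW q - triU q - (x 1 - x 0) : ℝ) : ℂ) *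
        (triIsoradialEmbedding.c (x - Pi.single 0 1, 1) - triIsoradialEmbedding.z x) +
      ((triU q - (2 * x 0 + x 1 - 1) : ℝ) : ℂ) *
        (triIsoradialEmbedding.c (x, 0) - triIsoradialEmbedding.z x) := by
    apply eq_parallelogram_point
    · rw [map_sub, map_sub, c1, c3, c7]; ring
    · rw [map_sub, map_sub, c2, c4, c8]; ring
  have hB : triIsoradialEmbedding.z x +
      (triIsoradialEmbedding.c (x - Pi.single 0 1, 1) - triIsoradialEmbedding.z x) +
      (triIsoradialEmbedding.c (x, 0) - triIsoradialEmbedding.z x) =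
      triIsoradialEmbedding.z (x + Pi.single 1 1) := by
    apply triUW_ext
    · simp only [map_add, map_sub, c1, c3, c5, c7]; ring
    · simp only [map_add, map_sub, c2, c4, c6, c8]; ring
  have key := mem_convexHull_parallelogram (triIsoradialEmbedding.z x)
    (triIsoradialEmbedding.c (x - Pi.single 0 1, 1) - triIsoradialEmbedding.z x)
    (triIsoradialEmbedding.c (x, 0) - triIsoradialEmbedding.z x)
    (s := triW q - triU q - (x 1 - x 0)) (t := triU q - (2 * x 0 + x 1 - 1))
    ⟨by linarith, by linarith⟩ ⟨by linarith, by linarith⟩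
  rw [hB, add_sub_cancel, add_sub_cancel] at key
  rw [hq]
  exact key

/-- **Rhombi of direction `ζ²` in coordinates** (closed form): `2x₀ + x₁ - 2 ≤ 𝑈 ≤ 2x₀ + x₁ - 1`
and `x₀ + 2x₁ - 1 ≤ 𝑊 ≤ x₀ + 2x₁`. [folklore] -/
theorem bounds_of_mem_rhombus_triDart2
    (hq : q ∈ triIsoradialEmbedding.rhombus ⟨(triDart2 x).edge, (triDart2 x).edge_mem⟩) :
    triU q ∈ Icc ((2 * x 0 + x 1 - 2 : ℤ) : ℝ) ((2 * x 0 + x 1 - 1 : ℤ) : ℝ) ∧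
      triW q ∈ Icc ((x 0 + 2 * x 1 - 1 : ℤ) : ℝ) ((x 0 + 2 * x 1 : ℤ) : ℝ) := by
  obtain ⟨⟨h1, h2⟩, ⟨h3, h4⟩, ⟨h5, h6⟩, ⟨h7, h8⟩⟩ := corners_triDart2 x
  rw [rhombus_triDart2] at hq
  constructor
  · refine linear_mem_Icc_of_mem_convexHull triU (fun X hX => ?_) hq
    simp only [mem_insert_iff, mem_singleton_iff] at hX
    rcases hX with rfl | rfl | rfl | rfl <;> simp only [h1, h3, h5, h7] <;>
      constructor <;> push_cast <;> linarith
  · refine linear_mem_Icc_of_mem_convexHull triW (fun X hX => ?_) hq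
    simp only [mem_insert_iff, mem_singleton_iff] at hX
    rcases hX with rfl | rfl | rfl | rfl <;> simp only [h2, h4, h6, h8] <;>
      constructor <;> push_cast <;> linarith

/-- **Rhombi of direction `ζ²` in coordinates** (interior form). [folklore] -/
theorem sbounds_of_mem_interior_rhombus_triDart2
    (hq : q ∈ interior (triIsoradialEmbedding.rhombus ⟨(triDart2 x).edge, (triDart2 x).edge_mem⟩)) :
    ((2 * x 0 + x 1 - 2 : ℤ) : ℝ) < triU q ∧ triU q < ((2 * x 0 + x 1 - 1 : ℤ) : ℝ) ∧
      ((x 0 + 2 * x 1 - 1 : ℤ) : ℝ) < triW q ∧ triW q < ((x 0 + 2 * x 1 : ℤ) : ℝ) := by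
  have hb := fun X (hX : X ∈ triIsoradialEmbedding.rhombus ⟨(triDart2 x).edge, (triDart2 x).edge_mem⟩) =>
    bounds_of_mem_rhombus_triDart2 hX
  exact ⟨linear_gt_of_mem_interior triU 1 triU_one_pos (fun X hX => (hb X hX).1.1) hq,
    linear_lt_of_mem_interior triU 1 triU_one_pos (fun X hX => (hb X hX).1.2) hq,
    linear_gt_of_mem_interior triW Complex.I triW_I_pos (fun X hX => (hb X hX).2.1) hq,
    linear_lt_of_mem_interior triW Complex.I triW_I_pos (fun X hX => (hb X hX).2.2) hq⟩

/-- **Rhombi of direction `ζ²` in coordinates** (converse). [folklore] -/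
theorem mem_rhombus_triDart2_of_bounds
    (h1 : ((2 * x 0 + x 1 - 2 : ℤ) : ℝ) ≤ triU q) (h2 : triU q ≤ ((2 * x 0 + x 1 - 1 : ℤ) : ℝ))
    (h3 : ((x 0 + 2 * x 1 - 1 : ℤ) : ℝ) ≤ triW q) (h4 : triW q ≤ ((x 0 + 2 * x 1 : ℤ) : ℝ)) :
    q ∈ triIsoradialEmbedding.rhombus ⟨(triDart2 x).edge, (triDart2 x).edge_mem⟩ := by
  obtain ⟨⟨c1, c2⟩, ⟨c3, c4⟩, ⟨c5, c6⟩, ⟨c7, c8⟩⟩ := corners_triDart2 x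
  rw [rhombus_triDart2]
  push_cast at h1 h2 h3 h4 c1 c2 c3 c4 c5 c6 c7 c8
  have hq : q = triIsoradialEmbedding.z x +
      (((2 * x 0 + x 1 - 1) - triU q : ℝ) : ℂ) *
        (triIsoradialEmbedding.c (x - Pi.single 0 1, 0) - triIsoradialEmbedding.z x) +
      ((triW q - (x 0 + 2 * x 1 - 1) : ℝ) : ℂ) *
        (triIsoradialEmbedding.c (x - Pi.single 0 1, 1) - triIsoradialEmbedding.z x) := by
    apply eq_parallelogram_point
    · rw [map_sub, map_sub, c1, c3, c7]; ring
    · rw [map_sub, map_sub, c2, c4, c8]; ring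
  have hB : triIsoradialEmbedding.z x +
      (triIsoradialEmbedding.c (x - Pi.single 0 1, 0) - triIsoradialEmbedding.z x) +
      (triIsoradialEmbedding.c (x - Pi.single 0 1, 1) - triIsoradialEmbedding.z x) =
      triIsoradialEmbedding.z (x - triDiag) := by
    apply triUW_ext
    · simp only [map_add, map_sub, c1, c3, c5, c7]; ring
    · simp only [map_add, map_sub, c2, c4, c6, c8]; ring
  have key := mem_convexHull_parallelogram (triIsoradialEmbedding.z x)
    (triIsoradialEmbedding.c (x - Pi.single 0 1, 0) - triIsoradialEmbedding.z x)
    (triIsoradialEmbedding.c (x - Pi.single 0 1, 1) - triIsoradialEmbedding.z x)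
    (s := (2 * x 0 + x 1 - 1) - triU q) (t := triW q - (x 0 + 2 * x 1 - 1))
    ⟨by linarith, by linarith⟩ ⟨by linarith, by linarith⟩
  rw [hB, add_sub_cancel, add_sub_cancel] at key
  rw [hq]
  exact key

end Regions

/-! ### Covering, disjointness, and the rhombic-tiling condition -/

section Tiling

/-- The vertex of `𝕋` with prescribed coordinates `(𝑈, 𝑊) = (u, w)`, which exists iff
`u + w ≡ 1 (mod 3)`. [folklore] -/
theorem exists_site_of_coords {u w : ℤ} (h : (u + w) % 3 = 1) :
    ∃ x : Site 2, 2 * x 0 + x 1 - 1 = u ∧ x 0 + 2 * x 1 - 1 = w :=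
  ⟨![(2 * (u + 1) - (w + 1)) / 3, (2 * (w + 1) - (u + 1)) / 3], by simp; omega, by simp; omega⟩

/-- **The rhombi of `𝕋` cover the plane.** With `m = ⌊𝑈 q⌋`, `n = ⌊𝑊 q⌋`: if `m + n ≡ 0 (mod 3)`
the point `q` lies in the `ζ²`-rhombus whose cell is `[m, m+1] × [n, n+1]`; otherwise it lies in a
horizontal or a `ζ`-rhombus through the vertex with `(𝑈, 𝑊) ∈ {(m, n), (m - 1, n), (m, n - 1)}`,
according to `m + n (mod 3)` and the order of the fractional parts of `𝑈 q`, `𝑊 q`.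
(Grimmett–Manolescu 2014, §2.1: the diamond graph of an isoradial graph is a rhombic tiling; here
the rhombille tiling.) [folklore] -/
theorem iUnion_rhombus_triIsoradialEmbedding :
    ⋃ e : triGraph.edgeSet, triIsoradialEmbedding.rhombus e = univ := by
  refine eq_univ_of_forall fun q => ?_
  rw [mem_iUnion]
  set m : ℤ := ⌊triU q⌋ with hm
  set n : ℤ := ⌊triW q⌋ with hn
  have hm1 : (m : ℝ) ≤ triU q := Int.floor_le _
  have hm2 : triU q < m + 1 := Int.lt_floor_add_one _
  have hn1 : (n : ℝ) ≤ triW q := Int.floor_le _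
  have hn2 : triW q < n + 1 := Int.lt_floor_add_one _
  rcases (show (m + n) % 3 = 0 ∨ (m + n) % 3 = 1 ∨ (m + n) % 3 = 2 by omega) with h0 | h1 | h2
  · obtain ⟨x, hx1, hx2⟩ := exists_site_of_coords (u := m + 1) (w := n) (by omega)
    refine ⟨⟨_, (triDart2 x).edge_mem⟩, mem_rhombus_triDart2_of_bounds ?_ ?_ ?_ ?_⟩
    · rw [show (2 * x 0 + x 1 - 2 : ℤ) = m by omega]; exact hm1
    · rw [show (2 * x 0 + x 1 - 1 : ℤ) = m + 1 by omega]; push_cast; exact hm2.le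
    · rw [show (x 0 + 2 * x 1 - 1 : ℤ) = n by omega]; exact hn1
    · rw [show (x 0 + 2 * x 1 : ℤ) = n + 1 by omega]; push_cast; exact hn2.le
  · obtain ⟨x, hx1, hx2⟩ := exists_site_of_coords (u := m) (w := n) h1
    by_cases hc : (m : ℝ) - n ≤ triU q - triW q
    · refine ⟨⟨_, (triDart0 x).edge_mem⟩, mem_rhombus_triDart0_of_bounds ?_ ?_ ?_ ?_⟩
      · rw [show (x 0 + 2 * x 1 - 1 : ℤ) = n by omega]; exact hn1
      · rw [show (x 0 + 2 * x 1 : ℤ) = n + 1 by omega]; push_cast; exact hn2.le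
      · rw [show (x 0 - x 1 : ℤ) = m - n by omega]; push_cast; exact hc
      · rw [show (x 0 - x 1 + 1 : ℤ) = m - n + 1 by omega]; push_cast; linarith
    · push Not at hc
      refine ⟨⟨_, (triDart1 x).edge_mem⟩, mem_rhombus_triDart1_of_bounds ?_ ?_ ?_ ?_⟩
      · rw [show (2 * x 0 + x 1 - 1 : ℤ) = m by omega]; exact hm1
      · rw [show (2 * x 0 + x 1 : ℤ) = m + 1 by omega]; push_cast; exact hm2.le
      · rw [show (x 1 - x 0 : ℤ) = n - m by omega]; push_cast; linarith
      · rw [show (x 1 - x 0 + 1 : ℤ) = n - m + 1 by omega]; push_cast; linarith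
  · by_cases hc : triU q - triW q ≤ (m : ℝ) - n
    · obtain ⟨x, hx1, hx2⟩ := exists_site_of_coords (u := m - 1) (w := n) (by omega)
      refine ⟨⟨_, (triDart0 x).edge_mem⟩, mem_rhombus_triDart0_of_bounds ?_ ?_ ?_ ?_⟩
      · rw [show (x 0 + 2 * x 1 - 1 : ℤ) = n by omega]; exact hn1
      · rw [show (x 0 + 2 * x 1 : ℤ) = n + 1 by omega]; push_cast; exact hn2.le
      · rw [show (x 0 - x 1 : ℤ) = m - n - 1 by omega]; push_cast; linarith
      · rw [show (x 0 - x 1 + 1 : ℤ) = m - n by omega]; push_cast; exact hc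
    · push Not at hc
      obtain ⟨x, hx1, hx2⟩ := exists_site_of_coords (u := m) (w := n - 1) (by omega)
      refine ⟨⟨_, (triDart1 x).edge_mem⟩, mem_rhombus_triDart1_of_bounds ?_ ?_ ?_ ?_⟩
      · rw [show (2 * x 0 + x 1 - 1 : ℤ) = m by omega]; exact hm1
      · rw [show (2 * x 0 + x 1 : ℤ) = m + 1 by omega]; push_cast; exact hm2.le
      · rw [show (x 1 - x 0 : ℤ) = n - m - 1 by omega]; push_cast; linarith
      · rw [show (x 1 - x 0 + 1 : ℤ) = n - m by omega]; push_cast; linarith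

/-- Two sites with the same coordinates `2x₀ + x₁`, `x₀ + 2x₁` are equal. [folklore] -/
theorem site_eq_of_coords {x x' : Site 2} (h1 : 2 * x 0 + x 1 = 2 * x' 0 + x' 1)
    (h2 : x 0 + 2 * x 1 = x' 0 + 2 * x' 1) : x = x' := by
  have e0 : x 0 = x' 0 := by omega
  have e1 : x 1 = x' 1 := by omega
  ext i
  fin_cases i
  · exact e0
  · exact e1

/-- **Interior points determine their rhombus**: a common interior point of the rhombi of two
edges of `𝕋` forces the edges to be equal (the open cells of the three families are pairwise
disjoint: a modular obstruction `mod 3` between families, unit cells within a family).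
[folklore] -/
theorem eq_of_mem_interior_rhombus_triIsoradialEmbedding {e e' : triGraph.edgeSet} {q : ℂ}
    (hq : q ∈ interior (triIsoradialEmbedding.rhombus e))
    (hq' : q ∈ interior (triIsoradialEmbedding.rhombus e')) : e = e' := by
  obtain ⟨x, hx⟩ := exists_triDart_edge e
  obtain ⟨x', hx'⟩ := exists_triDart_edge e'
  rcases hx with hx | hx | hx <;> rcases hx' with hx' | hx' | hx'
  · -- horizontal / horizontal
    obtain rfl : e = ⟨_, (triDart0 x).edge_mem⟩ := Subtype.ext hx.symm
    obtain rfl : e' = ⟨_, (triDart0 x').edge_mem⟩ := Subtype.ext hx'.symm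
    obtain ⟨a1, a2, a3, a4⟩ := sbounds_of_mem_interior_rhombus_triDart0 hq
    obtain ⟨b1, b2, b3, b4⟩ := sbounds_of_mem_interior_rhombus_triDart0 hq'
    have i1 : (x 0 + 2 * x 1 - 1 : ℤ) < x' 0 + 2 * x' 1 := by exact_mod_cast a1.trans b2
    have i2 : (x' 0 + 2 * x' 1 - 1 : ℤ) < x 0 + 2 * x 1 := by exact_mod_cast b1.trans a2
    have i3 : (x 0 - x 1 : ℤ) < x' 0 - x' 1 + 1 := by exact_mod_cast a3.trans b4
    have i4 : (x' 0 - x' 1 : ℤ) < x 0 - x 1 + 1 := by exact_mod_cast b3.trans a4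
    obtain rfl : x = x' := site_eq_of_coords (by omega) (by omega)
    rfl
  · -- horizontal / ζ
    exfalso
    obtain ⟨a1, a2, a3, a4⟩ := sbounds_of_mem_interior_rhombus_triDart0
      (x := x) (by rwa [show e = ⟨_, (triDart0 x).edge_mem⟩ from Subtype.ext hx.symm] at hq)
    obtain ⟨b1, b2, b3, b4⟩ := sbounds_of_mem_interior_rhombus_triDart1
      (x := x') (by rwa [show e' = ⟨_, (triDart1 x').edge_mem⟩ from Subtype.ext hx'.symm] at hq')
    -- W ∈ (w, w+1), U - W ∈ (k, k+1); U ∈ (u, u+1), W - U ∈ (j, j+1)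
    have i1 : (x 0 - x 1 : ℤ) < -(x' 1 - x' 0) := by
      have : ((x 0 - x 1 : ℤ) : ℝ) < -((x' 1 - x' 0 : ℤ) : ℝ) := by linarith
      exact_mod_cast this
    have i2 : (-(x' 1 - x' 0 + 1) : ℤ) < x 0 - x 1 + 1 := by
      have : ((-(x' 1 - x' 0 + 1) : ℤ) : ℝ) < ((x 0 - x 1 + 1 : ℤ) : ℝ) := by
        push_cast at a4 b4 ⊢; linarith
      exact_mod_cast this
    -- U = W + (U - W) ∈ (w + k, w + k + 2) meets (u, u + 1)
    have i3 : (2 * x' 0 + x' 1 - 1 : ℤ) < (x 0 + 2 * x 1) + (x 0 - x 1 + 1) := by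
      have : ((2 * x' 0 + x' 1 - 1 : ℤ) : ℝ) < ((x 0 + 2 * x 1 : ℤ) : ℝ) + ((x 0 - x 1 + 1 : ℤ) : ℝ) := by
        linarith
      exact_mod_cast this
    have i4 : (x 0 + 2 * x 1 - 1 : ℤ) + (x 0 - x 1) < 2 * x' 0 + x' 1 := by
      have : ((x 0 + 2 * x 1 - 1 : ℤ) : ℝ) + ((x 0 - x 1 : ℤ) : ℝ) < ((2 * x' 0 + x' 1 : ℤ) : ℝ) := by
        linarith
      exact_mod_cast this
    omega
  · -- horizontal / ζ²
    exfalso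
    obtain ⟨a1, a2, a3, a4⟩ := sbounds_of_mem_interior_rhombus_triDart0
      (x := x) (by rwa [show e = ⟨_, (triDart0 x).edge_mem⟩ from Subtype.ext hx.symm] at hq)
    obtain ⟨b1, b2, b3, b4⟩ := sbounds_of_mem_interior_rhombus_triDart2
      (x := x') (by rwa [show e' = ⟨_, (triDart2 x').edge_mem⟩ from Subtype.ext hx'.symm] at hq')
    have i1 : (x 0 + 2 * x 1 - 1 : ℤ) < x' 0 + 2 * x' 1 := by exact_mod_cast a1.trans b4
    have i2 : (x' 0 + 2 * x' 1 - 1 : ℤ) < x 0 + 2 * x 1 := by exact_mod_cast b3.trans a2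
    have i3 : (x 0 - x 1 : ℤ) < (2 * x' 0 + x' 1 - 1) - (x' 0 + 2 * x' 1 - 1) := by
      have : ((x 0 - x 1 : ℤ) : ℝ) < ((2 * x' 0 + x' 1 - 1 : ℤ) : ℝ) - ((x' 0 + 2 * x' 1 - 1 : ℤ) : ℝ) := by
        linarith
      exact_mod_cast this
    have i4 : (2 * x' 0 + x' 1 - 2 : ℤ) - (x' 0 + 2 * x' 1) < x 0 - x 1 + 1 := by
      have : ((2 * x' 0 + x' 1 - 2 : ℤ) : ℝ) - ((x' 0 + 2 * x' 1 : ℤ) : ℝ) < ((x 0 - x 1 + 1 : ℤ) : ℝ) := by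
        linarith
      exact_mod_cast this
    omega
  · -- ζ / horizontal
    exfalso
    obtain ⟨a1, a2, a3, a4⟩ := sbounds_of_mem_interior_rhombus_triDart1
      (x := x) (by rwa [show e = ⟨_, (triDart1 x).edge_mem⟩ from Subtype.ext hx.symm] at hq)
    obtain ⟨b1, b2, b3, b4⟩ := sbounds_of_mem_interior_rhombus_triDart0
      (x := x') (by rwa [show e' = ⟨_, (triDart0 x').edge_mem⟩ from Subtype.ext hx'.symm] at hq')
    have i1 : (x' 0 - x' 1 : ℤ) < -(x 1 - x 0) := by
      have : ((x' 0 - x' 1 : ℤ) : ℝ) < -((x 1 - x 0 : ℤ) : ℝ) := by linarith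
      exact_mod_cast this
    have i2 : (-(x 1 - x 0 + 1) : ℤ) < x' 0 - x' 1 + 1 := by
      have : ((-(x 1 - x 0 + 1) : ℤ) : ℝ) < ((x' 0 - x' 1 + 1 : ℤ) : ℝ) := by
        push_cast at a4 b4 ⊢; linarith
      exact_mod_cast this
    have i3 : (2 * x 0 + x 1 - 1 : ℤ) < (x' 0 + 2 * x' 1) + (x' 0 - x' 1 + 1) := by
      have : ((2 * x 0 + x 1 - 1 : ℤ) : ℝ) < ((x' 0 + 2 * x' 1 : ℤ) : ℝ) + ((x' 0 - x' 1 + 1 : ℤ) : ℝ) := by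
        linarith
      exact_mod_cast this
    have i4 : (x' 0 + 2 * x' 1 - 1 : ℤ) + (x' 0 - x' 1) < 2 * x 0 + x 1 := by
      have : ((x' 0 + 2 * x' 1 - 1 : ℤ) : ℝ) + ((x' 0 - x' 1 : ℤ) : ℝ) < ((2 * x 0 + x 1 : ℤ) : ℝ) := by
        linarith
      exact_mod_cast this
    omega
  · -- ζ / ζ
    obtain rfl : e = ⟨_, (triDart1 x).edge_mem⟩ := Subtype.ext hx.symm
    obtain rfl : e' = ⟨_, (triDart1 x').edge_mem⟩ := Subtype.ext hx'.symm
    obtain ⟨a1, a2, a3, a4⟩ := sbounds_of_mem_interior_rhombus_triDart1 hq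
    obtain ⟨b1, b2, b3, b4⟩ := sbounds_of_mem_interior_rhombus_triDart1 hq'
    have i1 : (2 * x 0 + x 1 - 1 : ℤ) < 2 * x' 0 + x' 1 := by exact_mod_cast a1.trans b2
    have i2 : (2 * x' 0 + x' 1 - 1 : ℤ) < 2 * x 0 + x 1 := by exact_mod_cast b1.trans a2
    have i3 : (x 1 - x 0 : ℤ) < x' 1 - x' 0 + 1 := by exact_mod_cast a3.trans b4
    have i4 : (x' 1 - x' 0 : ℤ) < x 1 - x 0 + 1 := by exact_mod_cast b3.trans a4
    obtain rfl : x = x' := site_eq_of_coords (by omega) (by omega)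
    rfl
  · -- ζ / ζ²
    exfalso
    obtain ⟨a1, a2, a3, a4⟩ := sbounds_of_mem_interior_rhombus_triDart1
      (x := x) (by rwa [show e = ⟨_, (triDart1 x).edge_mem⟩ from Subtype.ext hx.symm] at hq)
    obtain ⟨b1, b2, b3, b4⟩ := sbounds_of_mem_interior_rhombus_triDart2
      (x := x') (by rwa [show e' = ⟨_, (triDart2 x').edge_mem⟩ from Subtype.ext hx'.symm] at hq')
    have i1 : (2 * x 0 + x 1 - 1 : ℤ) < 2 * x' 0 + x' 1 - 1 := by exact_mod_cast a1.trans b2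
    have i2 : (2 * x' 0 + x' 1 - 2 : ℤ) < 2 * x 0 + x 1 := by exact_mod_cast b1.trans a2
    have i3 : (x 1 - x 0 : ℤ) < (x' 0 + 2 * x' 1) - (2 * x' 0 + x' 1 - 2) := by
      have : ((x 1 - x 0 : ℤ) : ℝ) < ((x' 0 + 2 * x' 1 : ℤ) : ℝ) - ((2 * x' 0 + x' 1 - 2 : ℤ) : ℝ) := by
        linarith
      exact_mod_cast this
    have i4 : (x' 0 + 2 * x' 1 - 1 : ℤ) - (2 * x' 0 + x' 1 - 1) < x 1 - x 0 + 1 := by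
      have : ((x' 0 + 2 * x' 1 - 1 : ℤ) : ℝ) - ((2 * x' 0 + x' 1 - 1 : ℤ) : ℝ) < ((x 1 - x 0 + 1 : ℤ) : ℝ) := by
        linarith
      exact_mod_cast this
    omega
  · -- ζ² / horizontal
    exfalso
    obtain ⟨a1, a2, a3, a4⟩ := sbounds_of_mem_interior_rhombus_triDart2
      (x := x) (by rwa [show e = ⟨_, (triDart2 x).edge_mem⟩ from Subtype.ext hx.symm] at hq)
    obtain ⟨b1, b2, b3, b4⟩ := sbounds_of_mem_interior_rhombus_triDart0
      (x := x') (by rwa [show e' = ⟨_, (triDart0 x').edge_mem⟩ from Subtype.ext hx'.symm] at hq')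
    have i1 : (x' 0 + 2 * x' 1 - 1 : ℤ) < x 0 + 2 * x 1 := by exact_mod_cast b1.trans a4
    have i2 : (x 0 + 2 * x 1 - 1 : ℤ) < x' 0 + 2 * x' 1 := by exact_mod_cast a3.trans b2
    have i3 : (x' 0 - x' 1 : ℤ) < (2 * x 0 + x 1 - 1) - (x 0 + 2 * x 1 - 1) := by
      have : ((x' 0 - x' 1 : ℤ) : ℝ) < ((2 * x 0 + x 1 - 1 : ℤ) : ℝ) - ((x 0 + 2 * x 1 - 1 : ℤ) : ℝ) := by
        linarith
      exact_mod_cast this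
    have i4 : (2 * x 0 + x 1 - 2 : ℤ) - (x 0 + 2 * x 1) < x' 0 - x' 1 + 1 := by
      have : ((2 * x 0 + x 1 - 2 : ℤ) : ℝ) - ((x 0 + 2 * x 1 : ℤ) : ℝ) < ((x' 0 - x' 1 + 1 : ℤ) : ℝ) := by
        linarith
      exact_mod_cast this
    omega
  · -- ζ² / ζ
    exfalso
    obtain ⟨a1, a2, a3, a4⟩ := sbounds_of_mem_interior_rhombus_triDart2
      (x := x) (by rwa [show e = ⟨_, (triDart2 x).edge_mem⟩ from Subtype.ext hx.symm] at hq)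
    obtain ⟨b1, b2, b3, b4⟩ := sbounds_of_mem_interior_rhombus_triDart1
      (x := x') (by rwa [show e' = ⟨_, (triDart1 x').edge_mem⟩ from Subtype.ext hx'.symm] at hq')
    have i1 : (2 * x' 0 + x' 1 - 1 : ℤ) < 2 * x 0 + x 1 - 1 := by exact_mod_cast b1.trans a2
    have i2 : (2 * x 0 + x 1 - 2 : ℤ) < 2 * x' 0 + x' 1 := by exact_mod_cast a1.trans b2
    have i3 : (x' 1 - x' 0 : ℤ) < (x 0 + 2 * x 1) - (2 * x 0 + x 1 - 2) := by
      have : ((x' 1 - x' 0 : ℤ) : ℝ) < ((x 0 + 2 * x 1 : ℤ) : ℝ) - ((2 * x 0 + x 1 - 2 : ℤ) : ℝ) := by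
        linarith
      exact_mod_cast this
    have i4 : (x 0 + 2 * x 1 - 1 : ℤ) - (2 * x 0 + x 1 - 1) < x' 1 - x' 0 + 1 := by
      have : ((x 0 + 2 * x 1 - 1 : ℤ) : ℝ) - ((2 * x 0 + x 1 - 1 : ℤ) : ℝ) < ((x' 1 - x' 0 + 1 : ℤ) : ℝ) := by
        linarith
      exact_mod_cast this
    omega
  · -- ζ² / ζ²
    obtain rfl : e = ⟨_, (triDart2 x).edge_mem⟩ := Subtype.ext hx.symm
    obtain rfl : e' = ⟨_, (triDart2 x').edge_mem⟩ := Subtype.ext hx'.symm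
    obtain ⟨a1, a2, a3, a4⟩ := sbounds_of_mem_interior_rhombus_triDart2 hq
    obtain ⟨b1, b2, b3, b4⟩ := sbounds_of_mem_interior_rhombus_triDart2 hq'
    have i1 : (2 * x 0 + x 1 - 2 : ℤ) < 2 * x' 0 + x' 1 - 1 := by exact_mod_cast a1.trans b2
    have i2 : (2 * x' 0 + x' 1 - 2 : ℤ) < 2 * x 0 + x 1 - 1 := by exact_mod_cast b1.trans a2
    have i3 : (x 0 + 2 * x 1 - 1 : ℤ) < x' 0 + 2 * x' 1 := by exact_mod_cast a3.trans b4
    have i4 : (x' 0 + 2 * x' 1 - 1 : ℤ) < x 0 + 2 * x 1 := by exact_mod_cast b3.trans a4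
    obtain rfl : x = x' := site_eq_of_coords (by omega) (by omega)
    rfl

/-- **The rhombi of distinct edges of `𝕋` have disjoint interiors.** [folklore] -/
theorem disjoint_interior_rhombus_triIsoradialEmbedding :
    Pairwise fun e e' : triGraph.edgeSet =>
      Disjoint (interior (triIsoradialEmbedding.rhombus e)) (interior (triIsoradialEmbedding.rhombus e')) :=
  fun _ _ hne => Set.disjoint_left.2 fun _ hq hq' =>
    hne (eq_of_mem_interior_rhombus_triIsoradialEmbedding hq hq')

/-- **Distinct faces of `𝕋` have distinct centres** (`𝑈, 𝑊` of the centre of `(y, t)` are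
`2y₀ + y₁ + t`, `y₀ + 2y₁ + t`). [folklore] -/
theorem c_injective_triIsoradialEmbedding : Function.Injective triIsoradialEmbedding.c := by
  rintro ⟨y, t⟩ ⟨y', t'⟩ h
  have hU := congrArg triU h
  have hW := congrArg triW h
  rw [triU_c, triU_c] at hU
  rw [triW_c, triW_c] at hW
  have hU' : (2 * y 0 + y 1 + (t : ℕ) : ℤ) = 2 * y' 0 + y' 1 + (t' : ℕ) := by exact_mod_cast hU
  have hW' : (y 0 + 2 * y 1 + (t : ℕ) : ℤ) = y' 0 + 2 * y' 1 + (t' : ℕ) := by exact_mod_cast hW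
  have ht := t.isLt
  have ht' := t'.isLt
  have e0 : y 0 = y' 0 := by omega
  have e1 : y 1 = y' 1 := by omega
  have et : (t : ℕ) = t' := by omega
  have hy : y = y' := by
    ext i
    fin_cases i
    · exact e0
    · exact e1
  rw [hy, Fin.ext et]

/-- **The diamond graph of `𝕋` is a rhombic tiling** (`RhombicEmbedding.IsRhombicTiling` for
`triIsoradialEmbedding`): the rhombi of distinct edges have disjoint interiors, the rhombi cover
the plane (the rhombille tiling), and the face centres are pairwise distinct. Together with
`triIsoradialEmbedding_isIsoradial` and `triIsoradialEmbedding_hasBoundedAngles` this puts the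
triangular lattice in the scope of the tree's planar-duality and box-crossing files for rhombic
tilings (`RhombicTilingPlanarity`, `IsoradialDualCrossings`, `IsoradialBoxCrossingAssembly`) and
discharges three of the four structural hypotheses of `gm_boxCrossing triGraph
triIsoradialEmbedding (π/6)` (the square-grid property remaining). (Grimmett–Manolescu, PTRF 159
(2014), §2.1: "`G` is isoradial if and only if its diamond graph `G^◇` is a rhombic tiling of the
plane"; the triangular lattice is listed in `𝒢`, §1.)
[cite: GrimmettManolescu2014Isoradial, §2.1 (isoradial ⇔ rhombic tiling of the diamond graph); §1 (𝒢 ∋ triangular lattice)] -/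
theorem triIsoradialEmbedding_isRhombicTiling : triIsoradialEmbedding.IsRhombicTiling where
  disjoint_interior := disjoint_interior_rhombus_triIsoradialEmbedding
  iUnion_rhombus := iUnion_rhombus_triIsoradialEmbedding
  c_injective := c_injective_triIsoradialEmbedding

end Tiling

end Literature.Probability.Percolation

end
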